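import Summits.ResolutionOfSingularities.ResolutionOfSingularities.Theses.SeparableGalois
import Literature.AlgebraicGeometry.Resolution.GaloisAlterationsQuasiProjective
import Literature.AlgebraicGeometry.Resolution.LogRegularScheme
import HarnessLib

/-!
# Vocabulary of the line `inseparability-foliation-quotient` for the crux `GaloisQuotientModels`
# (route `ResolutionOfSingularities/SeparableGalois`, item stmt-ResolutionOfSingularities-18955)

Route-posited objects and predicates (D-0016: `Theorems/<RouteSlug>…Defs.lean`) consumed by the
registered stubs of the line skeleton `Cruxes/GaloisQuotientModels/Lines/inseparability_foliation_quotient.lean`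
and by the stub files `Theorems/SeparableGaloisGaloisQuotientModels<Stub>.lean`. Nothing is proved here;
every declaration is a DEFINITION over existing tree vocabulary (`IsAlteration`, `IsBirational`,
`Scheme.IsRegular`, `RatFn.functionFieldMap`, `LogAtlas`), stated for schemes in universe `0` (the crux's).

* `GaloisQuotientConclusion X` — verbatim the ∃-block of the crux `SeparableGalois.GaloisQuotientModels` for
  one scheme `X`: a proper birational `X₁ → X`, `X₁` integral, presented as a Galois-type quotient
  `q : X' → X₁` of a regular integral `X'` by a finite group (finite, surjective, generically étale,
  invariant, fibres = orbits).
* `frobeniusCompositum π p n` — the subfield `Mₙ = K·L^{pⁿ}` of `L = K(X₁)` generated by `K = π♯ K(X)`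
  and the `pⁿ`-th powers (de Jong 1997, 5.3 (d): the purely inseparable defect lives between `K` and
  `L^G`; `Mₙ` is the function field of the level-`n` infinitesimal quotient).
* `IsGaloisAlterationOfExponent p n ρ π` — de Jong's Galois alteration datum (1997, 5.3 and Thm. 5.13, in
  the rendering of the tree's named fact `DeJong1997_galoisAlterationQuasiProjective`) with a UNIFORM
  bound `n` on the exponent of the defect: `a ∈ K(X₁)^G ⇒ a^{pⁿ} ∈ π♯ K(X)`.
* `IsSandwichModel p n ρ π ρZ u v` — a normal model `Z` of `Mₙ` squeezed `X₁ —u→ Z —v→ X`, `u` finite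
  surjective `G`-equivariant, `v` `G`-invariant, `u ≫ v = π`, `u♯ K(Z) = Mₙ`.
* `IsLogEquivariant 𝒜 ρZ` — a finite group acts on a Zariski log atlas `𝒜` (Kato 1994 (1.5)) by log
  automorphisms: stalk maps carry chart monoids onto chart monoids up to units.
* `HasSeparableGaloisTop X` — a regular SEPARABLE Galois top: a `G`-invariant alteration `π' : X' → X`
  from a regular integral `X'` with faithful finite `G`, finite subsets of `X'` in affine opens, and
  `K(X')^G = π'♯ K(X)` on the nose (de Jong's datum with exponent `0`; the separable form that
  Abramovich–Oort 2000, Question 2.13 does not ask).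

Sources: A. J. de Jong, *Families of curves and alterations*, Ann. Inst. Fourier 47 (1997), 5.3,
Thm. 5.13, Cor. 5.15; K. Kato, *Toric singularities*, Amer. J. Math. 116 (1994), (1.5)–(1.6), (2.1);
D. Abramovich, F. Oort, *Alterations and resolution of singularities* (2000), Question 2.13.
Design: predicates only (no named facts, no claims); the line's CLAIMS are the registered stubs. The
one theorem is the definitional glue `stub_galoisQuotientModels_iff` (`Iff.rfl`): the crux is, prime by
prime and scheme by scheme, `GaloisQuotientConclusion`.
-/

noncomputable section

-- single-problem summit: the doubled namespace component `ResolutionOfSingularities` is forced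
set_option linter.dupNamespace false

open CategoryTheory AlgebraicGeometry TopologicalSpace
open Literature.AlgebraicGeometry.Resolution
open Literature.AlgebraicGeometry.Motives Literature.AlgebraicGeometry.Motives.RatFn

namespace Summit.ResolutionOfSingularities.ResolutionOfSingularities.Theorems.GaloisQuotientModels

open Summit.ResolutionOfSingularities.ResolutionOfSingularities.Theses.SeparableGalois (GaloisQuotientModels)

/-- The ∃-block of the crux `SeparableGalois.GaloisQuotientModels` for one scheme `X` (verbatim its
body): a proper birational `π : X₁ → X` with `X₁` integral, and a Galois-type presentation
`q : X' → X₁` of `X₁` by a REGULAR integral `X'` — `q` finite, surjective, étale over a dense open,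
invariant under an action `ρ : G →* Aut X'` of a finite group whose orbits are the fibres of `q`.
[cite: DeJong1997, 5.3 and Cor. 5.15 (the quotient presentation, here WITHOUT the purely inseparable defect)] -/
def GaloisQuotientConclusion (X : Scheme.{0}) : Prop :=
  ∃ (X₁ X' : Scheme.{0}) (π : X₁ ⟶ X) (q : X' ⟶ X₁) (G : Type) (_ : Group G) (_ : Finite G)
    (ρ : G →* Aut X'), IsProper π ∧ IsBirational π ∧ IsIntegral X₁ ∧ IsIntegral X' ∧
    Scheme.IsRegular X' ∧ IsFinite q ∧ Function.Surjective q.base ∧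
    (∃ U : X₁.Opens, Dense (U : Set X₁) ∧ Etale (q ∣_ U)) ∧ (∀ g : G, (ρ g).hom ≫ q = q) ∧
    (∀ x y : X', q.base x = q.base y → ∃ g : G, (ρ g).hom.base x = y)

/-- The **Frobenius compositum of level `n`** inside `L = K(X₁)` for a dominant `π : X₁ → X`: the
subfield `Mₙ = K·L^{pⁿ}` generated by `K = π♯ K(X)` and all `pⁿ`-th powers of elements of `L` (in
characteristic `p` the latter form the subfield `L^{pⁿ}`). For de Jong's Galois alteration it is the
function field of the level-`n` infinitesimal quotient of `X₁` (the field of constants of the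
inseparability foliation of `π`). [cite: DeJong1997, 5.3 (d) and Thm. 5.13] -/
def frobeniusCompositum {X₁ X : Scheme.{0}} [IsIntegral X₁] [IsIntegral X] (π : X₁ ⟶ X)
    [IsDominant π] (p n : ℕ) : Subfield X₁.functionField :=
  Subfield.closure (Set.range (functionFieldMap π) ∪
    Set.range fun a : X₁.functionField => a ^ p ^ n)

/-- **A de Jong datum of exponent `n`**: `π : X₁ → X` a `G`-invariant alteration from a REGULAR
integral `X₁`, the finite group `G` acting faithfully through `ρ`, every finite subset of `X₁` in an
affine open (quasi-projectivity in the form the quotient construction consumes), and the purely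
inseparable defect of BOUNDED exponent: `a ∈ K(X₁)^G ⇒ a^{pⁿ} ∈ π♯ K(X)`. For `n = 0` this is a
SEPARABLE Galois alteration. (de Jong 1997, 5.3 (a)–(d) and Thm. 5.13 / Cor. 5.15, as rendered by the
tree's named fact `DeJong1997_galoisAlterationQuasiProjective`, plus the uniform exponent.)
[cite: DeJong1997, 5.3 and Thm. 5.13 / Cor. 5.15, pp. 613–620] -/
structure IsGaloisAlterationOfExponent {G : Type} [Group G] {X₁ X : Scheme.{0}} [IsIntegral X₁]
    [IsIntegral X] (p n : ℕ) (ρ : G →* Aut X₁) (π : X₁ ⟶ X) [IsDominant π] : Prop where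
  /-- `π` is an alteration (proper, dominant, generically finite, integral source) -/
  isAlteration : IsAlteration π
  /-- the source is regular -/
  isRegular : Scheme.IsRegular X₁
  /-- the action is faithful -/
  injective : Function.Injective ρ
  /-- `π` is `G`-invariant -/
  comp_eq : ∀ g : G, (ρ g).hom ≫ π = π
  /-- `X₁` is quasi-projective in the weak sense: every finite subset lies in an affine open -/
  exists_isAffineOpen : ∀ S : Finset X₁, ∃ U : X₁.Opens, IsAffineOpen U ∧ (↑S : Set X₁) ⊆ U
  /-- the defect `K(X) ⊆ K(X₁)^G` is purely inseparable of exponent `≤ n` -/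
  pow_mem : ∀ a : X₁.functionField, (∀ g : G, functionFieldMap (ρ g).hom a = a) →
    a ^ p ^ n ∈ Set.range (functionFieldMap π)

/-- **A normal sandwich model of level `n`** of the de Jong datum `(ρ, π)`: an integral NORMAL scheme
`Z` with a `G`-action `ρZ`, squeezed `X₁ —u→ Z —v→ X` with `u ≫ v = π`, `u` finite surjective and
`G`-equivariant, `v` `G`-invariant, and `u♯ K(Z) = Mₙ` (the Frobenius compositum) — i.e. `Z` is the
level-`n` infinitesimal quotient of `X₁` (`𝒪_Z = 𝒪_{X₁} ∩ Mₙ`), unique up to isomorphism because `Z`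
is normal and `u` is finite. [cite: DeJong1997, Thm. 5.13 (the datum); 5.3 (d)] -/
structure IsSandwichModel {G : Type} [Group G] {X₁ X Z : Scheme.{0}} [IsIntegral X₁] [IsIntegral X]
    [IsIntegral Z] (p n : ℕ) (ρ : G →* Aut X₁) (π : X₁ ⟶ X) [IsDominant π] (ρZ : G →* Aut Z)
    (u : X₁ ⟶ Z) [IsDominant u] (v : Z ⟶ X) : Prop where
  /-- `u` is `G`-equivariant -/
  comm : ∀ g : G, (ρ g).hom ≫ u = u ≫ (ρZ g).hom
  /-- `v` is `G`-invariant -/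
  inv : ∀ g : G, (ρZ g).hom ≫ v = v
  /-- the sandwich factors `π` -/
  fac : u ≫ v = π
  /-- `u` is finite -/
  isFinite : IsFinite u
  /-- `u` is surjective -/
  surjective : Function.Surjective u.base
  /-- the function field of `Z` is the Frobenius compositum `Mₙ` -/
  range_eq : Set.range (functionFieldMap u) = (frobeniusCompositum π p n : Set X₁.functionField)
  /-- `Z` is normal -/
  isIntegrallyClosed : ∀ z : Z, IsIntegrallyClosed (Z.presheaf.stalk z)

/-- **`G` acts on the Zariski log atlas `𝒜` by log automorphisms**: for every `g` and every point `z`,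
the stalk map of `ρZ g` at `z` carries the submonoid of `𝒪_{Z, g z}` generated by any chart at `g z`
onto the submonoid of `𝒪_{Z, z}` generated by any chart at `z`, UP TO UNITS (both inclusions — the same
shape as `LogAtlas.chart_compatible`, to which it reduces for `g = 1`). For the log structure
`M = 𝒪_Z ∩ j_*𝒪^×_{Z ∖ D}` of a `G`-invariant closed `D` this is automatic.
[cite: Kato1994, (1.5)–(1.6) and Def. (2.1)] -/
def IsLogEquivariant {Z : Scheme.{0}} (𝒜 : LogAtlas.{0} Z) {G : Type} [Group G]
    (ρZ : G →* Aut Z) : Prop :=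
  ∀ (g : G) (i j : 𝒜.ι) (z : Z) (hi : z ∈ 𝒜.U i) (hj : (ρZ g).hom.base z ∈ 𝒜.U j),
    (∀ q : 𝒜.P j, ∃ p' : 𝒜.P i,
      Associated (Z.presheaf.germ (𝒜.U i) z hi (𝒜.chart i (Multiplicative.ofAdd p')))
        ((ρZ g).hom.stalkMap z
          (Z.presheaf.germ (𝒜.U j) ((ρZ g).hom.base z) hj (𝒜.chart j (Multiplicative.ofAdd q))))) ∧
    (∀ p' : 𝒜.P i, ∃ q : 𝒜.P j,
      Associated (Z.presheaf.germ (𝒜.U i) z hi (𝒜.chart i (Multiplicative.ofAdd p')))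
        ((ρZ g).hom.stalkMap z
          (Z.presheaf.germ (𝒜.U j) ((ρZ g).hom.base z) hj (𝒜.chart j (Multiplicative.ofAdd q)))))

/-- **A regular SEPARABLE Galois top** of the integral scheme `X`: a `G`-invariant alteration
`π' : X' → X` from a REGULAR integral `X'` with a faithful action of a finite group `G`, every finite
subset of `X'` in an affine open, and NO inseparable defect: `K(X')^G = π'♯ K(X)` on the nose (de Jong's
Galois alteration datum 5.3 with exponent `0`; the separable form of Abramovich–Oort 2000, Cor. 2.9,
which their Question 2.13 does not ask for). [cite: DeJong1997, 5.3]
[cite: AbramovichOort2000, Cor. 2.9 and Question 2.13, p. 8–9] -/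
def HasSeparableGaloisTop (X : Scheme.{0}) [IsIntegral X] : Prop :=
  ∃ (G : Type) (_ : Group G) (_ : Finite G) (X' : Scheme.{0}) (_ : IsIntegral X')
    (ρ' : G →* Aut X') (π' : X' ⟶ X) (_ : IsDominant π'),
    IsAlteration π' ∧ Scheme.IsRegular X' ∧ Function.Injective ρ' ∧
    (∀ g : G, (ρ' g).hom ≫ π' = π') ∧
    (∀ S : Finset X', ∃ U : X'.Opens, IsAffineOpen U ∧ (↑S : Set X') ⊆ U) ∧
    (∀ a : X'.functionField, (∀ g : G, functionFieldMap (ρ' g).hom a = a) →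
      a ∈ Set.range (functionFieldMap π'))

/-- **Definitional glue** (read-back of the crux): `GaloisQuotientModels` is, prime by prime, field by
field and scheme by scheme, the statement `GaloisQuotientConclusion X` — by `Iff.rfl`. This is what the
last stub of the line (`HasSeparableGaloisTop X → GaloisQuotientConclusion X`) is composed with.
[cite: DeJong1997, Cor. 5.15 (the shape of the conclusion)] -/
theorem stub_galoisQuotientModels_iff : GaloisQuotientModels ↔
    ∀ p : ℕ, p.Prime → ∀ (k : Type) [Field k] [CharP k p] [PerfectField k] (X : Scheme.{0})
      (f : X ⟶ Spec (.of k)), IsSeparated f → LocallyOfFiniteType f → QuasiCompact f →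
      IsIntegral X → GaloisQuotientConclusion X :=
  Iff.rfl

end Summit.ResolutionOfSingularities.ResolutionOfSingularities.Theorems.GaloisQuotientModels

end
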